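import Summits.BirchSwinnertonDyer.BirchSwinnertonDyer.Theorems.GenusKolyvaginAtTwoPowDvdShaCardAtTwoPosT
import HarnessLib

/-!
# Route `GenusKolyvaginAtTwo`, LINE 24 «strict_def2» of the residual crux `OffCutResidualAtTwoR` (stmt-BirchSwinnertonDyer-31767), stub X⁼²
# `stub_kolyvaginExactAtTwoPosDiscDefectTwo`: **its LOWER HALF is DEFECT-FREE** (`2^(2M₀) ∣ #Ш(E/K)[2^∞]` on the Δ>0 cut for a 2-Selmer-minimal twin of ANY
# Tamagawa defect), and **X⁼² ⟸ its upper half U⁼² alone** (critic #456 P1: X⁼² = X⁼²_low «families» + B⁼² «defect-2 budget»)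

Seat `bsd-line-gk2-p5` g40 (WIDTH-5 attach, cell `bsd-f1-sign2`), `--supports stmt-BirchSwinnertonDyer-31767` (helper; closes nothing).
THEOREMS ONLY (no definition, no named fact, no `sorry`).  **BSD is NOT proved by any of this**; the residual crux is NOT closed; X⁼² itself is NOT
proved (its upper half U⁼² — the defect-2 budget in the pair sandwich, case-split at the identity prime `q ∣ d_K` — remains the open stub).

OBSERVATION.  The landed L⁺_T′ `…Theorems.powDvdShaCardAtTwoPosT_proof` (gk2-p2 g22, road (E4)⁺: capstone-with-sockets
`pow_dvd_natCard_sha_of_sockets_of_rank_le_one_transposition` + R⁺ `mordellWeilRank_baseChange_le_one_onPosCut` + the transposition sockets) never uses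
its binder `padicValNat 2 Wd.tamagawaProduct = 0` (it is `_hTam` in the landed proof): the Tamagawa defect of the twin enters Kolyvagin's EXHIBITION
half nowhere — `rank E(K) ≤ 1` needs only `#Sel₂(Wd) = 2` (B2Q⁺ gives `rank E(ℚ) = 0`, the 2-descent count gives `rank E^(d_K)(ℚ) ≤ 1`).  Hence:
* `powDvdShaCardAtTwoPosT_defectFree` — `PowDvdShaCardAtTwoPosT` (stmt-BirchSwinnertonDyer-25501) with the Tamagawa clause DELETED (proof = the landed
  one verbatim, one binder fewer);
* `kolyvaginExactAtTwoPosDiscDefectTwo_lowerHalf` — X⁼²'s binders VERBATIM (`padicValNat 2 Wd.tamagawaProduct = 2`), conclusion `2^(2M₀) ∣ #Ш(E/K)[2^∞]`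
  = critic #456 P1's item X⁼²_low, PROVED;
* `kolyvaginExactAtTwoPosDiscDefectTwo_of_upperHalf` — **X⁼² VERBATIM ⟸ U⁼²** (:= `ShaCardDvdPowAtTwoPosT` with `= 2` for `= 0`, i.e. `#Ш(E/K)[2^∞] ∣ 2^(2M₀)`
  at defect 2) by `Nat.dvd_antisymm`: the defect-2 budget B⁼² is the WHOLE remaining content of X⁼².
What the budget needs (not proved here): at the identity prime `q` the local norm index of E is `#E(ℚ_q)[2] = 4` and the twin has `c_q(Wd) = 4`, so the
tree's by-name fallback (`relIndex_sha_comap_resBaseChange_le_two_pow_succ_of_arch` and its `_twin_` form) only gives `A·A′ ≤ 64`, `#Ш(E/K)[2^∞] ∣ 4^(M₀+2)`;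
sharpness in CASE A (`loc_q : Sel₂(E/ℚ) ↠ E(ℚ_q)/2`) = no relaxed-at-`q` class beyond Selmer (Poitou–Tate at `T = {∞, q}`), in CASE B Kramer's
capitulation identity.  [Kramer1981] Thm. 1, Prop. 3; [MazurRubin2010] Prop. 3.3; [McCallumLMS1991] §5.

References: [McCallumLMS1991] §5 Prop. 5.2, Thm. 5.4, Cor. 5.6; [Kolyvagin1991StructureSha]; [GrossLMS1991] §10; [Kramer1981] Thm. 1.
-/

set_option autoImplicit false
-- the Theorems namespace of this sub repeats the summit name by design (D-0017 nested layout)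
set_option linter.dupNamespace false

noncomputable section

open scoped Classical
open scoped AddSubgroup
open Function Field NumberField IsDedekindDomain WeierstrassCurve
open Literature.NumberTheory.EllipticCurves Literature.NumberTheory.GaloisRepresentations
open Literature.NumberTheory.EllipticCurves.ModularForms
open Literature.NumberTheory.GaloisCohomology
open Summit.BirchSwinnertonDyer.Rank1Residual.JET.GlobalDuality
open Summit.BirchSwinnertonDyer.BirchSwinnertonDyer.Theses.GenusKolyvaginAtTwo
open Summit.BirchSwinnertonDyer.Rank1Residual
open Summit.BirchSwinnertonDyer.BirchSwinnertonDyer.Theorems.GenusExact.PlusDescent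
open Summit.BirchSwinnertonDyer.BirchSwinnertonDyer.Theorems

namespace Summit.BirchSwinnertonDyer.BirchSwinnertonDyer.Theorems.GenusExact.StrictDefTwo

/-- **L⁺_T′ DEFECT-FREE: `PowDvdShaCardAtTwoPosT` (stmt-BirchSwinnertonDyer-25501) WITHOUT its Tamagawa clause** — on the Δ>0 cut of the habitat (odd
multiplicative prime `v`, `w(E) = 1`, a globally minimal twin `Wd ≅ E^(d_K)` with `#Sel₂(Wd) = 2` of ANY Tamagawa defect), from Q2 and a transposition-deep
Kolyvagin witness: `2^(2M₀) ∣ #Ш(E/K)[2^∞]`.  Proof = gk2-p2 g22's `powDvdShaCardAtTwoPosT_proof` VERBATIM (its `_hTam` binder was idle).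
[cite: McCallumLMS1991, §5 Prop. 5.2, Thm. 5.4] [cite: Kolyvagin1991StructureSha] [cite: GrossLMS1991, §1 Thm. 1.3, §10] [cite: Kramer1981, Thm. 1] -/
theorem powDvdShaCardAtTwoPosT_defectFree :
    KolyvaginRelationAtTwo → ∀ (W : WeierstrassCurve ℚ) [W.IsElliptic] [W.IsGloballyMinimal] [NeZero (W.conductorNorm ℤ)], ¬ W.HasCM → Odd W.tamagawaProduct → ∀ (v : IsDedekindDomain.HeightOneSpectrum (NumberField.RingOfIntegers ℚ)), ((2 : ℕ) : NumberField.RingOfIntegers ℚ) ∉ v.asIdeal → ((W.conductorNorm ℤ : ℕ) : NumberField.RingOfIntegers ℚ) ∈ v.asIdeal → W.HasMultiplicativeReductionAt v → 0 < W.Δ → ∀ (K : Type) [Field K] [NumberField K], Literature.NumberTheory.EllipticCurves.IsImaginaryQuadratic K → Odd (NumberField.discr K) → NumberField.discr K ≠ -3 → Literature.NumberTheory.EllipticCurves.SatisfiesHeegnerHypothesis (W.conductorNorm ℤ) K → ¬ IsSquare ((NumberField.discr K : ℚ) * -|W.Δ|) → ¬ IsSquare ((NumberField.discr K : ℚ)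 * (-(2 * |W.Δ|))) → (∀ n : ℕ, 0 < n → W.HasSurjectiveModNGaloisRep ((2 : ℤ) ^ n)) → ∀ (Dt : Literature.NumberTheory.EllipticCurves.ModularForms.ModularParametrizationData W (W.conductorNorm ℤ)) (β : ℤ) (ι : K →+* ℂ) (d₁ : Literature.NumberTheory.EllipticCurves.KolyvaginHeegnerData Dt β ι 1), ¬ IsOfFinAddOrder d₁.derivedPoint → ∀ (M₀ : ℕ), (∃ Q : (W.baseChange (Literature.NumberTheory.EllipticCurves.ringClassField K ι 1)).toAffine.Point, ((2 ^ M₀ : ℕ) : ℤ) • Q = d₁.derivedPoint) → (¬ ∃ Q : (W.baseChange (Literature.NumberTheory.EllipticCurves.ringClassField K ι 1)).toAffine.Point, ((2 ^ (M₀ + 1) : ℕ) : ℤ) • Q = d₁.derivedPoint) → W.rootNumber = 1 → ∀ (Wd : WeierstrassCurve ℚ) [Wd.IsElliptic] [Wd.IsGloballyMinimal], (∃ C : WeierstrassCurve.VariableChange ℚ, C • W.quadraticTwist (NumberField.discr K : ℚ) = Wd) → Nat.card (Wd.selmerGroup 2) = 2 → ∀ (n : ℕ) (d : Literature.NumberTheory.EllipticCurves.KolyvaginHeegnerData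 Dt β ι n), Squarefree n → (∀ ℓ ∈ n.primeFactors, Literature.NumberTheory.EllipticCurves.Zhang2014.IsKolyvaginPrime (W.conductorNorm ℤ) W K 2 ℓ ∧ 2 ≤ Literature.NumberTheory.EllipticCurves.Zhang2014.kolyvaginIndex W 2 ℓ ∧ ∃ (v : IsDedekindDomain.HeightOneSpectrum (NumberField.RingOfIntegers ℚ)) (𝔓 : Ideal (Literature.NumberTheory.GaloisRepresentations.absIntegers (NumberField.RingOfIntegers ℚ) ℚ)) (h : Field.absoluteGaloisGroup ℚ), ((ℓ : ℕ) : NumberField.RingOfIntegers ℚ) ∈ v.asIdeal ∧ 𝔓 ∈ v.primesAbove ∧ IsArithFrobAt (NumberField.RingOfIntegers ℚ) h 𝔓 ∧ ∃ u : W.geomTorsion ((2 : ℕ) : ℤ), h • u ≠ u) → (¬ ∃ Q : (W.baseChange (Literature.NumberTheory.EllipticCurves.ringClassField K ι n)).toAffine.Point, (2 : ℤ) • Q = d.derivedPoint) → 2 ^ (2 * M₀) ∣ Nat.card (AddCommGroup.primaryComponent (W.baseChange K).sha 2) := by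
  intro hQ2 W _ _ _ hcm hT v h2v hNv hmult _hpos K _ _ hIQ hodd h3 hHe hsq1 hsq2 hρ Dt β ι d₁ hy M₀ hdiv hndiv hw Wd _ _ hWd hSel
    n₀ e₀ hn₀ hKoly he₀
  obtain ⟨τ, hτ, -⟩ := exists_conj_of_isImaginaryQuadratic (K := K) hIQ
  haveI : ∀ j : ℕ, NumberField (ringClassField K ι j) := JET.numberField_ringClassField K hIQ ι
  have hsurN' : ∀ m : ℕ, W.HasSurjectiveModNGaloisRep (2 ^ m : ℕ) := fun m ↦ by
    exact_mod_cast Summit.BirchSwinnertonDyer.BirchSwinnertonDyer.Theorems.MinimalTwinBSDTwo.forall_hasSurjectiveModNGaloisRep_two_pow_of_pos W hρ m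
  -- R⁺: `rank E(K) ≤ 1` on the cut (this seat, `…PosTRankLeOnePosCut`, p758733)
  have hrk : (W.baseChange K).mordellWeilRank ≤ 1 :=
    mordellWeilRank_baseChange_le_one_onPosCut hQ2 W hcm hT v h2v hNv hmult K hIQ hodd h3 hHe hsq1 hsq2 hρ Dt β ι d₁ hy M₀ hndiv hw Wd hWd hSel
  -- the item's witness clause in the Theorems' spelling (`geomTorsion W 2`)
  have hKoly' : ∀ ℓ ∈ n₀.primeFactors, Zhang2014.IsKolyvaginPrime (W.conductorNorm ℤ) W K 2 ℓ ∧ 2 ≤ Zhang2014.kolyvaginIndex W 2 ℓ ∧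
      ∃ (v : HeightOneSpectrum (𝓞 ℚ)) (𝔓 : Ideal (absIntegers (𝓞 ℚ) ℚ)) (h : absoluteGaloisGroup ℚ),
        (ℓ : 𝓞 ℚ) ∈ v.asIdeal ∧ 𝔓 ∈ v.primesAbove ∧ IsArithFrobAt (𝓞 ℚ) h 𝔓 ∧ ∃ u : geomTorsion W 2, h • u ≠ u := by
    intro ℓ hℓ
    obtain ⟨hZ, hidx, v', 𝔓, h, hv', h𝔓, hfr, hu⟩ := hKoly ℓ hℓ
    exact ⟨hZ, hidx, v', 𝔓, h, hv', h𝔓, hfr, exists_smul_ne_two_of_natCast W hu⟩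
  exact pow_dvd_natCard_sha_of_sockets_of_rank_le_one_transposition hQ2 W hcm hT v h2v hNv hmult K hIQ hodd h3 hHe hsq1 hsq2 hρ Dt β ι d₁ hy
    M₀ hdiv hndiv hrk τ hτ
    (exists_transposition_kolyvaginPrime_localization_fullOrder_pair_deep W K hIQ hodd hHe hsurN' τ hτ (2 * (M₀ + 6)) 1 (by omega))
    (GenusExact.TransverseValue.hbot_socket_margin_onHabitat_of_three_le_transposition W hQ2 hcm hT hsurN' hIQ hodd h3 hHe hsq1 hsq2 h2v hNv hmult
      Dt β ι (L := 2 * (M₀ + 6)) (by omega) 1 (by omega) _ (fun q _ hidx hF ↦ ⟨hidx, hF⟩) hn₀ hKoly' e₀ he₀)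
    (deepSwap_socket_transposition W hcm hT hsurN' hIQ hodd h3 hHe τ hτ Dt β ι hQ2 (M₀ := M₀) (L := 2 * (M₀ + 6)) (k := 1) (by omega) le_rfl
      (Summit.BirchSwinnertonDyer.BirchSwinnertonDyer.Theorems.GenusExact.NonPhantomPow.nonPhantomAtTwo_of_hasMultiplicativeReductionAt W hT hρ hIQ hodd hsq1 hsq2 (NeZero.ne (W.conductorNorm ℤ)) hHe h2v hNv hmult
        (2 * (M₀ + 6) + 1) (by omega)))
    (fun r ℓ hℓ C hC ↦ hK_socket_margin_of_frob_smul_ne W hIQ hτ (L := 2 * (M₀ + 6)) (by omega) r 1 ℓ hℓ C hC)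

/-- **X⁼²_low (critic #456 P1) PROVED: the lower half of LINE 24's stub X⁼² `stub_kolyvaginExactAtTwoPosDiscDefectTwo`** — X⁼²'s binders VERBATIM
(`padicValNat 2 Wd.tamagawaProduct = 2`), conclusion `2^(2M₀) ∣ #Ш(E/K)[2^∞]`; = `powDvdShaCardAtTwoPosT_defectFree` with the defect clause discarded.
[cite: McCallumLMS1991, §5 Prop. 5.2, Thm. 5.4] [cite: Kolyvagin1991StructureSha] -/
theorem kolyvaginExactAtTwoPosDiscDefectTwo_lowerHalf :
    KolyvaginRelationAtTwo → ∀ (W : WeierstrassCurve ℚ) [W.IsElliptic] [W.IsGloballyMinimal] [NeZero (W.conductorNorm ℤ)], ¬ W.HasCM → Odd W.tamagawaProduct → ∀ (v : IsDedekindDomain.HeightOneSpectrum (NumberField.RingOfIntegers ℚ)), ((2 : ℕ) : NumberField.RingOfIntegers ℚ) ∉ v.asIdeal → ((W.conductorNorm ℤ : ℕ) : NumberField.RingOfIntegers ℚ) ∈ v.asIdeal → W.HasMultiplicativeReductionAt v → 0 < W.Δ → ∀ (K : Type) [Field K] [NumberField K], Literature.NumberTheory.EllipticCurves.IsImaginaryQuadratic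 K → Odd (NumberField.discr K) → NumberField.discr K ≠ -3 → Literature.NumberTheory.EllipticCurves.SatisfiesHeegnerHypothesis (W.conductorNorm ℤ) K → ¬ IsSquare ((NumberField.discr K : ℚ) * -|W.Δ|) → ¬ IsSquare ((NumberField.discr K : ℚ) * (-(2 * |W.Δ|))) → (∀ n : ℕ, 0 < n → W.HasSurjectiveModNGaloisRep ((2 : ℤ) ^ n)) → ∀ (Dt : Literature.NumberTheory.EllipticCurves.ModularForms.ModularParametrizationData W (W.conductorNorm ℤ)) (β : ℤ) (ι : K →+* ℂ) (d₁ : Literature.NumberTheory.EllipticCurves.KolyvaginHeegnerData Dt β ι 1), ¬ IsOfFinAddOrder d₁.derivedPoint → ∀ (M₀ : ℕ), (∃ Q : (W.baseChange (Literature.NumberTheory.EllipticCurves.ringClassField K ι 1)).toAffine.Point, ((2 ^ M₀ : ℕ) : ℤ) • Q = d₁.derivedPoint) → (¬ ∃ Q : (W.baseChange (Literature.NumberTheory.EllipticCurves.ringClassField K ι 1)).toAffine.Point, ((2 ^ (M₀ + 1) : ℕ) : ℤ) • Q = d₁.derivedPoint) → W.rootNumber = 1 → ∀ (Wd : WeierstrassCurve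 ℚ) [Wd.IsElliptic] [Wd.IsGloballyMinimal], (∃ C : WeierstrassCurve.VariableChange ℚ, C • W.quadraticTwist (NumberField.discr K : ℚ) = Wd) → Nat.card (Wd.selmerGroup 2) = 2 → padicValNat 2 Wd.tamagawaProduct = 2 → ∀ (n : ℕ) (d : Literature.NumberTheory.EllipticCurves.KolyvaginHeegnerData Dt β ι n), Squarefree n → (∀ ℓ ∈ n.primeFactors, Literature.NumberTheory.EllipticCurves.Zhang2014.IsKolyvaginPrime (W.conductorNorm ℤ) W K 2 ℓ ∧ 2 ≤ Literature.NumberTheory.EllipticCurves.Zhang2014.kolyvaginIndex W 2 ℓ ∧ ∃ (v : IsDedekindDomain.HeightOneSpectrum (NumberField.RingOfIntegers ℚ)) (𝔓 : Ideal (Literature.NumberTheory.GaloisRepresentations.absIntegers (NumberField.RingOfIntegers ℚ) ℚ)) (h : Field.absoluteGaloisGroup ℚ), ((ℓ : ℕ) : NumberField.RingOfIntegers ℚ) ∈ v.asIdeal ∧ 𝔓 ∈ v.primesAbove ∧ IsArithFrobAt (NumberField.RingOfIntegers ℚ) h 𝔓 ∧ ∃ u : W.geomTorsion ((2 : ℕ)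 : ℤ), h • u ≠ u) → (¬ ∃ Q : (W.baseChange (Literature.NumberTheory.EllipticCurves.ringClassField K ι n)).toAffine.Point, (2 : ℤ) • Q = d.derivedPoint) → 2 ^ (2 * M₀) ∣ Nat.card (AddCommGroup.primaryComponent (W.baseChange K).sha 2) := by
  intro hQ2 W _ _ _ hcm hT v h2v hNv hmult hpos K _ _ hIQ hodd h3 hHe hsq1 hsq2 hρ Dt β ι d₁ hy M₀ hdiv hndiv hw Wd _ _ hWd hSel _hTam
    n d hn hKoly hPn
  exact powDvdShaCardAtTwoPosT_defectFree hQ2 W hcm hT v h2v hNv hmult hpos K hIQ hodd h3 hHe hsq1 hsq2 hρ Dt β ι d₁ hy M₀ hdiv hndiv hw Wd hWd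
    hSel n d hn hKoly hPn

/-- **X⁼² ⟸ U⁼² (the defect-2 budget is ALL that remains of X⁼²).**  LINE 24's stub X⁼² `stub_kolyvaginExactAtTwoPosDiscDefectTwo` VERBATIM (Q4_T′
`KolyvaginExactAtTwoPosDiscT` with `padicValNat 2 Wd.tamagawaProduct = 2`) follows from its UPPER half alone — U⁼² := U⁺_T′ `ShaCardDvdPowAtTwoPosT`
(stmt-BirchSwinnertonDyer-25500) with `= 2` for `= 0`, i.e. `#Ш(E/K)[2^∞] ∣ 2^(2M₀)` for a 2-Selmer-minimal twin of Tamagawa defect 2 — by `Nat.dvd_antisymm`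
with `kolyvaginExactAtTwoPosDiscDefectTwo_lowerHalf`.  U⁼² (= critic #456 P1's B⁼², case-split at the identity prime `q ∣ d_K`) is NOT proved here.
[cite: McCallumLMS1991, §5 Cor. 5.6] [cite: Kramer1981, Thm. 1] -/
theorem kolyvaginExactAtTwoPosDiscDefectTwo_of_upperHalf
    (hU : KolyvaginRelationAtTwo → ∀ (W : WeierstrassCurve ℚ) [W.IsElliptic] [W.IsGloballyMinimal] [NeZero (W.conductorNorm ℤ)], ¬ W.HasCM → Odd W.tamagawaProduct → ∀ (v : IsDedekindDomain.HeightOneSpectrum (NumberField.RingOfIntegers ℚ)), ((2 : ℕ) : NumberField.RingOfIntegers ℚ) ∉ v.asIdeal → ((W.conductorNorm ℤ : ℕ) : NumberField.RingOfIntegers ℚ) ∈ v.asIdeal → W.HasMultiplicativeReductionAt v → 0 < W.Δ → ∀ (K : Type) [Field K] [NumberField K], Literature.NumberTheory.EllipticCurves.IsImaginaryQuadratic K → Odd (NumberField.discr K) → NumberField.discr K ≠ -3 → Literature.NumberTheory.EllipticCurves.SatisfiesHeegnerHypothesis (W.conductorNorm ℤ) K → ¬ IsSquare ((NumberField.discr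 K : ℚ) * -|W.Δ|) → ¬ IsSquare ((NumberField.discr K : ℚ) * (-(2 * |W.Δ|))) → (∀ n : ℕ, 0 < n → W.HasSurjectiveModNGaloisRep ((2 : ℤ) ^ n)) → ∀ (Dt : Literature.NumberTheory.EllipticCurves.ModularForms.ModularParametrizationData W (W.conductorNorm ℤ)) (β : ℤ) (ι : K →+* ℂ) (d₁ : Literature.NumberTheory.EllipticCurves.KolyvaginHeegnerData Dt β ι 1), ¬ IsOfFinAddOrder d₁.derivedPoint → ∀ (M₀ : ℕ), (∃ Q : (W.baseChange (Literature.NumberTheory.EllipticCurves.ringClassField K ι 1)).toAffine.Point, ((2 ^ M₀ : ℕ) : ℤ) • Q = d₁.derivedPoint) → (¬ ∃ Q : (W.baseChange (Literature.NumberTheory.EllipticCurves.ringClassField K ι 1)).toAffine.Point, ((2 ^ (M₀ + 1) : ℕ) : ℤ) • Q = d₁.derivedPoint) → W.rootNumber = 1 → ∀ (Wd : WeierstrassCurve ℚ) [Wd.IsElliptic] [Wd.IsGloballyMinimal], (∃ C : WeierstrassCurve.VariableChange ℚ, C • W.quadraticTwist (NumberField.discr K : ℚ) = Wd) → Nat.card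 (Wd.selmerGroup 2) = 2 → padicValNat 2 Wd.tamagawaProduct = 2 → Nat.card (AddCommGroup.primaryComponent (W.baseChange K).sha 2) ∣ 2 ^ (2 * M₀)) :
    KolyvaginRelationAtTwo → ∀ (W : WeierstrassCurve ℚ) [W.IsElliptic] [W.IsGloballyMinimal] [NeZero (W.conductorNorm ℤ)], ¬ W.HasCM → Odd W.tamagawaProduct → ∀ (v : IsDedekindDomain.HeightOneSpectrum (NumberField.RingOfIntegers ℚ)), ((2 : ℕ) : NumberField.RingOfIntegers ℚ) ∉ v.asIdeal → ((W.conductorNorm ℤ : ℕ) : NumberField.RingOfIntegers ℚ) ∈ v.asIdeal → W.HasMultiplicativeReductionAt v → 0 < W.Δ → ∀ (K : Type) [Field K] [NumberField K], Literature.NumberTheory.EllipticCurves.IsImaginaryQuadratic K → Odd (NumberField.discr K) → NumberField.discr K ≠ -3 → Literature.NumberTheory.EllipticCurves.SatisfiesHeegnerHypothesis (W.conductorNorm ℤ) K → ¬ IsSquare ((NumberField.discr K : ℚ) * -|W.Δ|) → ¬ IsSquare ((NumberField.discr K : ℚ) * (-(2 * |W.Δ|))) → (∀ n : ℕ, 0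 < n → W.HasSurjectiveModNGaloisRep ((2 : ℤ) ^ n)) → ∀ (Dt : Literature.NumberTheory.EllipticCurves.ModularForms.ModularParametrizationData W (W.conductorNorm ℤ)) (β : ℤ) (ι : K →+* ℂ) (d₁ : Literature.NumberTheory.EllipticCurves.KolyvaginHeegnerData Dt β ι 1), ¬ IsOfFinAddOrder d₁.derivedPoint → ∀ (M₀ : ℕ), (∃ Q : (W.baseChange (Literature.NumberTheory.EllipticCurves.ringClassField K ι 1)).toAffine.Point, ((2 ^ M₀ : ℕ) : ℤ) • Q = d₁.derivedPoint) → (¬ ∃ Q : (W.baseChange (Literature.NumberTheory.EllipticCurves.ringClassField K ι 1)).toAffine.Point, ((2 ^ (M₀ + 1) : ℕ) : ℤ) • Q = d₁.derivedPoint) → W.rootNumber = 1 → ∀ (Wd : WeierstrassCurve ℚ) [Wd.IsElliptic] [Wd.IsGloballyMinimal], (∃ C : WeierstrassCurve.VariableChange ℚ, C • W.quadraticTwist (NumberField.discr K : ℚ) = Wd) → Nat.card (Wd.selmerGroup 2) = 2 → padicValNat 2 Wd.tamagawaProduct = 2 → ∀ (n : ℕ) (d : Literature.NumberTheory.EllipticCurves.KolyvaginHeegnerData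 Dt β ι n), Squarefree n → (∀ ℓ ∈ n.primeFactors, Literature.NumberTheory.EllipticCurves.Zhang2014.IsKolyvaginPrime (W.conductorNorm ℤ) W K 2 ℓ ∧ 2 ≤ Literature.NumberTheory.EllipticCurves.Zhang2014.kolyvaginIndex W 2 ℓ ∧ ∃ (v : IsDedekindDomain.HeightOneSpectrum (NumberField.RingOfIntegers ℚ)) (𝔓 : Ideal (Literature.NumberTheory.GaloisRepresentations.absIntegers (NumberField.RingOfIntegers ℚ) ℚ)) (h : Field.absoluteGaloisGroup ℚ), ((ℓ : ℕ) : NumberField.RingOfIntegers ℚ) ∈ v.asIdeal ∧ 𝔓 ∈ v.primesAbove ∧ IsArithFrobAt (NumberField.RingOfIntegers ℚ) h 𝔓 ∧ ∃ u : W.geomTorsion ((2 : ℕ) : ℤ), h • u ≠ u) → (¬ ∃ Q : (W.baseChange (Literature.NumberTheory.EllipticCurves.ringClassField K ι n)).toAffine.Point, (2 : ℤ) • Q = d.derivedPoint) → Nat.card (AddCommGroup.primaryComponent (W.baseChange K).sha 2) = 2 ^ (2 * M₀) := by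
  intro hQ2 W _ _ _ hcm hT v h2v hNv hmult hpos K _ _ hIQ hodd h3 hHe hsq1 hsq2 hρ Dt β ι d₁ hy M₀ hdiv hndiv hw Wd _ _ hWd hSel hTam
    n d hn hKoly hPn
  exact Nat.dvd_antisymm
    (hU hQ2 W hcm hT v h2v hNv hmult hpos K hIQ hodd h3 hHe hsq1 hsq2 hρ Dt β ι d₁ hy M₀ hdiv hndiv hw Wd hWd hSel hTam)
    (kolyvaginExactAtTwoPosDiscDefectTwo_lowerHalf hQ2 W hcm hT v h2v hNv hmult hpos K hIQ hodd h3 hHe hsq1 hsq2 hρ Dt β ι d₁ hy M₀ hdiv hndiv hw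
      Wd hWd hSel hTam n d hn hKoly hPn)

end Summit.BirchSwinnertonDyer.BirchSwinnertonDyer.Theorems.GenusExact.StrictDefTwo

end
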